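import Literature.MathematicalPhysics.QuantumManyBody.OneCoordinateMarginalRegularity
import Summits.AtomisticToContinuum.BoseEinsteinCondensation.Theorems.BECTangentRigidityRigidMomentumBoundStubFirstVariation
import Summits.AtomisticToContinuum.BoseEinsteinCondensation.Theorems.BECTangentRigidityRigidMomentumBoundStubWeightedGroupFloor
import HarnessLib

/-!
# Route `BECTangentRigidity`, crux `RigidMomentumBound` (stmt-AtomisticToContinuum-13034):
# stub `stub_slicePackageFinite` — the finite-`k` slice package

For ONE finite-energy bosonic trial state `Φ` of `n + 1` particles in the Dirichlet box `Λ_L`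
and a direction `a`, the one-coordinate slice data of particle `0` in the wall coordinate
`s = L - x_{0,a}` — marginal mass `M(s) = m(L - s)`, "momentum" `P(s) = -2 j(L - s) = M'(s)`,
normal slice kinetic energy `ET(s) = e_t(L - s)` and full slice energy `E(s) = e(L - s)` —
satisfy the package consumed by the limit extraction of the local virial route:

* regularity: `M` is continuous (indeed `C¹`, `hasDerivAt_marginalMassReal`), `M(0) = m(L) = 0`
  (the slice `x_{0,a} = L` misses the open box), `M ≥ 0`; `j`, `e_t`, `e` are integrable on `ℝ`
  (Fubini along the coordinate, `integrable_integral_comp_sliceMap`);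
* the primitive relation `M(s) = ∫₀ˢ P` (fundamental theorem of calculus);
* Cauchy–Schwarz `P² ≤ 4 M·ET`, `ET ≥ 0`, and `ET ≤ E` a.e. (`|∂_{0,a}Φ|²` is one term of the
  energy density; a.e. because the real slice energy is a Bochner integral);
* the APPROXIMATE LOCAL VIRIAL IDENTITY: the first variation `stub_firstVariation` (brick F1) at
  the `δ`-near-minimiser `Φ` under the multiplier `G(X) = g(L - x_{0,a})` (`|g| ≤ 1`,
  `|g'| ≤ D`), its three configuration-space integrals converted into wall-coordinate integrals of
  the slice data by the identities of `OneCoordinateMarginalMultiplier.lean`;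
* the SLICE BOUND `∫ g·ET + E₀(n, L) ∫ g·M ≤ ∫ g·E` for `0 ≤ g ≤ 1`: the weighted group floor
  `stub_weightedGroupFloor` (brick F2, particles `1, …, n` unconstrained in the box, weight
  `g(L - x_{0,a})`) plus the pointwise sub-sum inequalities `|∂_{0,a}Φ|² + ∑_{i≥1}|∇ᵢΦ|² ≤ |∇Φ|²`,
  `∑_{1≤i<j} v ≤ ∑_{i<j} v`, converted to real wall-coordinate integrals.
-/

noncomputable section

namespace Summit.AtomisticToContinuum.BoseEinsteinCondensation.Theorems.RigidMomentumBound

open MeasureTheory Filter Set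
open scoped ENNReal NNReal BigOperators
open Literature.MathematicalPhysics.QuantumManyBody.BoseGas

namespace SlicePackageFinite

variable {n : ℕ} {L : ℝ} {v : ℝ → ℝ≥0∞}

/-- **Approximate local virial identity in wall coordinates.** For a finite-energy
`δ`-near-minimiser `Φ` of `n + 1` bosons, a coordinate `p`, and a `C¹` test function `g` with
`|g| ≤ 1`, `|g'| ≤ D`:
`|∫₀ᴸ g E + ½ ∫₀ᴸ g' P − E_Φ ∫₀ᴸ g M| ≤ √δ (3 E_Φ + 2 D² + δ + 1) + δ`
(first variation `stub_firstVariation` under `G(X) = g(L - x_p)` + the three multiplier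
identities + the passage to the wall coordinate `s = L - t`). -/
theorem abs_virial_le (hv : Measurable v) (hL : 0 < L) (Φ : TrialState (n + 1) L)
    (hE : energy v Φ ≠ ⊤) (p : Fin (n + 1) × Fin 3) {g : ℝ → ℝ} (hg : ContDiff ℝ 1 g)
    (hg1 : ∀ s, |g s| ≤ 1) {D : ℝ} (hD0 : 0 ≤ D) (hgD : ∀ s, |deriv g s| ≤ D) {δ : ℝ}
    (hδ : 0 < δ) (hΦδ : energy v Φ ≤ groundStateEnergy v (n + 1) L + ENNReal.ofReal δ) :
    |(∫ s in (0 : ℝ)..L, g s * sliceEnergyReal v Φ.ψ p (L - s)) +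
        (1 / 2) * (∫ s in (0 : ℝ)..L, deriv g s * (-2 * sliceCurrent Φ.ψ p (L - s))) -
        (energy v Φ).toReal * ∫ s in (0 : ℝ)..L, g s * marginalMassReal Φ.ψ p (L - s)| ≤
      Real.sqrt δ * (3 * (energy v Φ).toReal + 2 * D ^ 2 + δ + 1) + δ := by
  have hgd : Differentiable ℝ g := hg.differentiable one_ne_zero
  have hGc : ContDiff ℝ 1 fun X : Config (n + 1) => g (L - X p.1 p.2) := contDiff_comp_coord hg L p
  have hG1 : ∀ X : Config (n + 1), |g (L - X p.1 p.2)| ≤ 1 := fun X => hg1 _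
  have hGD : ∀ X : Config (n + 1), ∑ i : Fin (n + 1), ∑ k : Fin 3,
      (fderiv ℝ (fun X : Config (n + 1) => g (L - X p.1 p.2)) X (unitVec i k)) ^ 2 ≤ D ^ 2 := by
    intro X
    rw [sum_fderiv_comp_coord_sq hgd L p X, ← sq_abs]
    exact pow_le_pow_left₀ (abs_nonneg _) (hgD _) 2
  have hF1 := stub_firstVariation v hv Φ (fun X : Config (n + 1) => g (L - X p.1 p.2)) D hGc hG1
    hGD hD0 hE δ hδ hΦδ
  -- the three identities, in wall coordinates
  have e1 : ∫ X, g (L - X p.1 p.2) *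
      (kineticDensity Φ.ψ X + interaction v X * (‖Φ.ψ X‖₊ : ℝ≥0∞) ^ 2).toReal =
      ∫ s in (0 : ℝ)..L, g s * sliceEnergyReal v Φ.ψ p (L - s) := by
    rw [integral_weight_energyDensity_eq hv Φ hE hg.continuous ⟨1, hg1⟩ L p]
    exact integral_weight_mul_eq_intervalIntegral hL.le
      (fun t ht => sliceEnergyReal_eq_zero_of_not_mem v Φ p ht) g
  have e2 : ∫ X, ∑ i : Fin (n + 1), ∑ k : Fin 3,
      fderiv ℝ (fun X : Config (n + 1) => g (L - X p.1 p.2)) X (unitVec i k) *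
        RCLike.re (starRingEnd ℂ (Φ.ψ X) * fderiv ℝ Φ.ψ X (unitVec i k)) =
      -∫ s in (0 : ℝ)..L, deriv g s * sliceCurrent Φ.ψ p (L - s) := by
    rw [integral_sum_fderiv_weight_re_eq Φ hg ⟨D, hgD⟩ L p,
      integral_weight_mul_eq_intervalIntegral hL.le
        (fun t ht => sliceCurrent_eq_zero_of_not_mem Φ p ht) (deriv g)]
  have e3 : ∫ X, g (L - X p.1 p.2) * ‖Φ.ψ X‖ ^ 2 =
      ∫ s in (0 : ℝ)..L, g s * marginalMassReal Φ.ψ p (L - s) := by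
    rw [integral_weight_normSq_eq Φ hg.continuous ⟨1, hg1⟩ L p]
    exact integral_weight_mul_eq_intervalIntegral hL.le
      (fun t ht => marginalMassReal_eq_zero_of_not_mem Φ p ht) g
  have e4 : ∫ s in (0 : ℝ)..L, deriv g s * (-2 * sliceCurrent Φ.ψ p (L - s)) =
      -2 * ∫ s in (0 : ℝ)..L, deriv g s * sliceCurrent Φ.ψ p (L - s) := by
    rw [← intervalIntegral.integral_const_mul]
    refine intervalIntegral.integral_congr fun s _ => ?_
    ring
  have key : (∫ s in (0 : ℝ)..L, g s * sliceEnergyReal v Φ.ψ p (L - s)) +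
        (1 / 2) * (∫ s in (0 : ℝ)..L, deriv g s * (-2 * sliceCurrent Φ.ψ p (L - s))) -
        (energy v Φ).toReal * ∫ s in (0 : ℝ)..L, g s * marginalMassReal Φ.ψ p (L - s) =
      (∫ X, g (L - X p.1 p.2) *
          (kineticDensity Φ.ψ X + interaction v X * (‖Φ.ψ X‖₊ : ℝ≥0∞) ^ 2).toReal) +
        (∫ X, ∑ i : Fin (n + 1), ∑ k : Fin 3,
          fderiv ℝ (fun X : Config (n + 1) => g (L - X p.1 p.2)) X (unitVec i k) *
            RCLike.re (starRingEnd ℂ (Φ.ψ X) * fderiv ℝ Φ.ψ X (unitVec i k))) -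
        (energy v Φ).toReal * ∫ X, g (L - X p.1 p.2) * ‖Φ.ψ X‖ ^ 2 := by
    rw [e1, e2, e3, e4]; ring
  rw [key]
  exact hF1

/-- **Weighted group floor with particle `0`'s normal derivative added** (lower integrals): for
any measurable weight `w(x₀)`,
`∫ w|∂_{0,a}Φ|² + E₀(n, L) ∫ w|Φ|² ≤ ∫ w e_Φ` — `stub_weightedGroupFloor` plus the pointwise
sub-sum inequalities `|∂_{0,a}Φ|² + ∑_{i ≥ 1}|∇ᵢΦ|² ≤ |∇Φ|²` and `∑_{1 ≤ i < j} v ≤ ∑_{i<j} v`. -/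
theorem lintegral_weight_sliceBound (hv : Measurable v) (Φ : TrialState (n + 1) L) (a : Fin 3)
    {w : Space → ℝ≥0∞} (hw : Measurable w) :
    (∫⁻ X, w (X 0) * (‖fderiv ℝ Φ.ψ X (unitVec 0 a)‖₊ : ℝ≥0∞) ^ 2) +
        groundStateEnergy v n L * ∫⁻ X, w (X 0) * (‖Φ.ψ X‖₊ : ℝ≥0∞) ^ 2 ≤
      ∫⁻ X, w (X 0) * (kineticDensity Φ.ψ X + interaction v X * (‖Φ.ψ X‖₊ : ℝ≥0∞) ^ 2) := by
  have hF2 := stub_weightedGroupFloor v hv Φ w hw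
  have hwm : Measurable fun X : Config (n + 1) => w (X 0) := hw.comp (measurable_pi_apply 0)
  have hnm : Measurable fun X : Config (n + 1) =>
      w (X 0) * (‖fderiv ℝ Φ.ψ X (unitVec 0 a)‖₊ : ℝ≥0∞) ^ 2 :=
    hwm.mul ((((Φ.contDiff.continuous_fderiv one_ne_zero).clm_apply
      continuous_const).measurable.nnnorm.coe_nnreal_ennreal).pow_const 2)
  calc (∫⁻ X, w (X 0) * (‖fderiv ℝ Φ.ψ X (unitVec 0 a)‖₊ : ℝ≥0∞) ^ 2) +
        groundStateEnergy v n L * ∫⁻ X, w (X 0) * (‖Φ.ψ X‖₊ : ℝ≥0∞) ^ 2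
      ≤ (∫⁻ X, w (X 0) * (‖fderiv ℝ Φ.ψ X (unitVec 0 a)‖₊ : ℝ≥0∞) ^ 2) +
          ∫⁻ X, w (X 0) * (∑ i : Fin n, ∑ k : Fin 3,
              (‖fderiv ℝ Φ.ψ X (unitVec i.succ k)‖₊ : ℝ≥0∞) ^ 2 +
            interaction v (fun i : Fin n => X i.succ) * (‖Φ.ψ X‖₊ : ℝ≥0∞) ^ 2) :=
        add_le_add le_rfl hF2
    _ = ∫⁻ X, (w (X 0) * (‖fderiv ℝ Φ.ψ X (unitVec 0 a)‖₊ : ℝ≥0∞) ^ 2 +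
          w (X 0) * (∑ i : Fin n, ∑ k : Fin 3,
              (‖fderiv ℝ Φ.ψ X (unitVec i.succ k)‖₊ : ℝ≥0∞) ^ 2 +
            interaction v (fun i : Fin n => X i.succ) * (‖Φ.ψ X‖₊ : ℝ≥0∞) ^ 2)) :=
        (lintegral_add_left hnm _).symm
    _ ≤ _ := lintegral_mono fun X => ?_
  rw [← mul_add, kineticDensity_succ]
  gcongr ?_ * ?_
  · exact le_rfl
  calc (‖fderiv ℝ Φ.ψ X (unitVec 0 a)‖₊ : ℝ≥0∞) ^ 2 +
        (∑ i : Fin n, ∑ k : Fin 3, (‖fderiv ℝ Φ.ψ X (unitVec i.succ k)‖₊ : ℝ≥0∞) ^ 2 +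
          interaction v (fun i : Fin n => X i.succ) * (‖Φ.ψ X‖₊ : ℝ≥0∞) ^ 2)
      = ((‖fderiv ℝ Φ.ψ X (unitVec 0 a)‖₊ : ℝ≥0∞) ^ 2 +
          ∑ i : Fin n, ∑ k : Fin 3, (‖fderiv ℝ Φ.ψ X (unitVec i.succ k)‖₊ : ℝ≥0∞) ^ 2) +
          interaction v (fun i : Fin n => X i.succ) * (‖Φ.ψ X‖₊ : ℝ≥0∞) ^ 2 := by ring
    _ ≤ ((∑ k : Fin 3, (‖fderiv ℝ Φ.ψ X (unitVec 0 k)‖₊ : ℝ≥0∞) ^ 2) +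
          ∑ i : Fin n, ∑ k : Fin 3, (‖fderiv ℝ Φ.ψ X (unitVec i.succ k)‖₊ : ℝ≥0∞) ^ 2) +
          interaction v X * (‖Φ.ψ X‖₊ : ℝ≥0∞) ^ 2 := by
        gcongr
        · exact Finset.single_le_sum
            (f := fun k : Fin 3 => (‖fderiv ℝ Φ.ψ X (unitVec 0 k)‖₊ : ℝ≥0∞) ^ 2)
            (fun _ _ => zero_le) (Finset.mem_univ a)
        · exact interaction_succ_le v X

/-- **The slice bound in wall coordinates**: for a finite-energy `Φ` and a continuous `g` with
`0 ≤ g ≤ 1`, `∫₀ᴸ g ET + E₀(n, L) ∫₀ᴸ g M ≤ ∫₀ᴸ g E` (`lintegral_weight_sliceBound` with the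
weight `g(L - x_{0,a})`, moved to real slice integrals; all three lower integrals are finite
because the weight is at most `1` and the energy is finite). -/
theorem sliceBound_real (hv : Measurable v) (hL : 0 < L) (Φ : TrialState (n + 1) L)
    (hE : energy v Φ ≠ ⊤) (a : Fin 3) {g : ℝ → ℝ} (hgc : Continuous g) (hg0 : ∀ s, 0 ≤ g s)
    (hg1 : ∀ s, g s ≤ 1) :
    (∫ s in (0 : ℝ)..L, g s * normalSliceEnergyReal Φ.ψ ((0 : Fin (n + 1)), a) (L - s)) +
        (groundStateEnergy v n L).toReal *
          (∫ s in (0 : ℝ)..L, g s * marginalMassReal Φ.ψ ((0 : Fin (n + 1)), a) (L - s)) ≤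
      ∫ s in (0 : ℝ)..L, g s * sliceEnergyReal v Φ.ψ ((0 : Fin (n + 1)), a) (L - s) := by
  have hgb : ∃ C, ∀ t, |g t| ≤ C := ⟨1, fun t => by rw [abs_of_nonneg (hg0 t)]; exact hg1 t⟩
  have hw : Measurable fun x : Space => ENNReal.ofReal (g (L - x a)) := by
    refine ENNReal.measurable_ofReal.comp (hgc.measurable.comp (measurable_const.sub ?_))
    exact (show Continuous fun x : Space => x a by fun_prop).measurable
  have hS1 := lintegral_weight_sliceBound hv Φ a hw
  have hdm : Measurable fun X : Config (n + 1) =>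
      kineticDensity Φ.ψ X + interaction v X * (‖Φ.ψ X‖₊ : ℝ≥0∞) ^ 2 :=
    measurable_energyDensity hv Φ.contDiff.continuous
  have hfin : ∫⁻ X : Config (n + 1), ENNReal.ofReal (g (L - X 0 a)) *
      (kineticDensity Φ.ψ X + interaction v X * (‖Φ.ψ X‖₊ : ℝ≥0∞) ^ 2) ≠ ⊤ := by
    refine ne_top_of_le_ne_top (by rwa [energy] at hE) (lintegral_mono fun X => ?_)
    calc ENNReal.ofReal (g (L - X 0 a)) *
          (kineticDensity Φ.ψ X + interaction v X * (‖Φ.ψ X‖₊ : ℝ≥0∞) ^ 2)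
        ≤ 1 * (kineticDensity Φ.ψ X + interaction v X * (‖Φ.ψ X‖₊ : ℝ≥0∞) ^ 2) := by
          gcongr; exact ENNReal.ofReal_le_one.2 (hg1 _)
      _ = _ := one_mul _
  have hA : ∫⁻ X : Config (n + 1), ENNReal.ofReal (g (L - X 0 a)) *
      (‖fderiv ℝ Φ.ψ X (unitVec 0 a)‖₊ : ℝ≥0∞) ^ 2 ≠ ⊤ :=
    ne_top_of_le_ne_top hfin (le_self_add.trans hS1)
  have hB : groundStateEnergy v n L * ∫⁻ X : Config (n + 1), ENNReal.ofReal (g (L - X 0 a)) *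
      (‖Φ.ψ X‖₊ : ℝ≥0∞) ^ 2 ≠ ⊤ :=
    ne_top_of_le_ne_top hfin (le_add_self.trans hS1)
  have hreal := ENNReal.toReal_mono hfin hS1
  rw [ENNReal.toReal_add hA hB, ENNReal.toReal_mul] at hreal
  have i1 : (∫⁻ X : Config (n + 1), ENNReal.ofReal (g (L - X 0 a)) *
      (‖fderiv ℝ Φ.ψ X (unitVec 0 a)‖₊ : ℝ≥0∞) ^ 2).toReal =
      ∫ s in (0 : ℝ)..L, g s * normalSliceEnergyReal Φ.ψ ((0 : Fin (n + 1)), a) (L - s) := by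
    have h := toReal_lintegral_weight_nnnorm_fderiv_sq Φ hgc hg0 hgb L ((0 : Fin (n + 1)), a)
    rw [integral_weight_mul_eq_intervalIntegral hL.le
      (fun t ht => normalSliceEnergyReal_eq_zero_of_not_mem Φ _ ht) g] at h
    exact h
  have i2 : (∫⁻ X : Config (n + 1), ENNReal.ofReal (g (L - X 0 a)) *
      (‖Φ.ψ X‖₊ : ℝ≥0∞) ^ 2).toReal =
      ∫ s in (0 : ℝ)..L, g s * marginalMassReal Φ.ψ ((0 : Fin (n + 1)), a) (L - s) := by
    have h := toReal_lintegral_weight_normSq Φ hgc hg0 hgb L ((0 : Fin (n + 1)), a)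
    rw [integral_weight_mul_eq_intervalIntegral hL.le
      (fun t ht => marginalMassReal_eq_zero_of_not_mem Φ _ ht) g] at h
    exact h
  have i3 : (∫⁻ X : Config (n + 1), ENNReal.ofReal (g (L - X 0 a)) *
      (kineticDensity Φ.ψ X + interaction v X * (‖Φ.ψ X‖₊ : ℝ≥0∞) ^ 2)).toReal =
      ∫ s in (0 : ℝ)..L, g s * sliceEnergyReal v Φ.ψ ((0 : Fin (n + 1)), a) (L - s) := by
    have h := toReal_lintegral_weight_energyDensity hv Φ hE hgc hg0 hgb L ((0 : Fin (n + 1)), a)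
    rw [integral_weight_mul_eq_intervalIntegral hL.le
      (fun t ht => sliceEnergyReal_eq_zero_of_not_mem v Φ _ ht) g] at h
    exact h
  rw [i1, i2, i3] at hreal
  exact hreal

end SlicePackageFinite

open SlicePackageFinite

/-- **G4c `stub_slicePackageFinite`** — the one-coordinate slice data of ONE finite-energy trial
state `Φ` of `n + 1` bosons in `Λ_L`, in wall coordinates `s = L - x_{0,a}`: continuity,
vanishing at the wall and nonnegativity of the marginal mass `M`; integrability of the slice
current, the normal slice kinetic energy `ET` and the full slice energy `E`; the primitive
relation `M(s) = ∫₀ˢ P` with `P = -2 j`; Cauchy–Schwarz `P² ≤ 4 M ET`, `ET ≥ 0`, `ET ≤ E` a.e.;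
the approximate local virial identity at a `δ`-near-minimiser (brick F1 under the multiplier
`g(L - x_{0,a})`); and the slice bound `∫ g ET + E₀(n, L) ∫ g M ≤ ∫ g E` (brick F2 with the
weight `g(L - x_{0,a})`). -/
theorem stub_slicePackageFinite :
    ∀ (v : ℝ → ℝ≥0∞), Measurable v → ∀ (n : ℕ) (L : ℝ), 0 < L → ∀ (Φ : TrialState (n + 1) L),
      energy v Φ ≠ ⊤ → ∀ a : Fin 3,
      (Continuous fun s : ℝ => marginalMassReal Φ.ψ ((0 : Fin (n + 1)), a) (L - s)) ∧
      marginalMassReal Φ.ψ ((0 : Fin (n + 1)), a) L = 0 ∧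
      (∀ s : ℝ, 0 ≤ marginalMassReal Φ.ψ ((0 : Fin (n + 1)), a) (L - s)) ∧
      Integrable (fun s : ℝ => sliceCurrent Φ.ψ ((0 : Fin (n + 1)), a) (L - s)) ∧
      Integrable (fun s : ℝ => normalSliceEnergyReal Φ.ψ ((0 : Fin (n + 1)), a) (L - s)) ∧
      Integrable (fun s : ℝ => sliceEnergyReal v Φ.ψ ((0 : Fin (n + 1)), a) (L - s)) ∧
      (∀ s : ℝ, marginalMassReal Φ.ψ ((0 : Fin (n + 1)), a) (L - s) =
        ∫ x in (0 : ℝ)..s, -2 * sliceCurrent Φ.ψ ((0 : Fin (n + 1)), a) (L - x)) ∧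
      (∀ s : ℝ, 0 ≤ normalSliceEnergyReal Φ.ψ ((0 : Fin (n + 1)), a) (L - s) ∧
        (-2 * sliceCurrent Φ.ψ ((0 : Fin (n + 1)), a) (L - s)) ^ 2 ≤
          4 * marginalMassReal Φ.ψ ((0 : Fin (n + 1)), a) (L - s) *
            normalSliceEnergyReal Φ.ψ ((0 : Fin (n + 1)), a) (L - s)) ∧
      (∀ᵐ s : ℝ, normalSliceEnergyReal Φ.ψ ((0 : Fin (n + 1)), a) (L - s) ≤
        sliceEnergyReal v Φ.ψ ((0 : Fin (n + 1)), a) (L - s)) ∧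
      (∀ g : ℝ → ℝ, ContDiff ℝ 1 g → (∀ s, |g s| ≤ 1) → ∀ D : ℝ, 0 ≤ D → (∀ s, |deriv g s| ≤ D) →
        ∀ δ : ℝ, 0 < δ → energy v Φ ≤ groundStateEnergy v (n + 1) L + ENNReal.ofReal δ →
        |(∫ s in (0 : ℝ)..L, g s * sliceEnergyReal v Φ.ψ ((0 : Fin (n + 1)), a) (L - s)) +
            (1 / 2) * (∫ s in (0 : ℝ)..L,
              deriv g s * (-2 * sliceCurrent Φ.ψ ((0 : Fin (n + 1)), a) (L - s))) -
            (energy v Φ).toReal *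
              ∫ s in (0 : ℝ)..L, g s * marginalMassReal Φ.ψ ((0 : Fin (n + 1)), a) (L - s)| ≤
          Real.sqrt δ * (3 * (energy v Φ).toReal + 2 * D ^ 2 + δ + 1) + δ) ∧
      (∀ g : ℝ → ℝ, ContDiff ℝ 1 g → (∀ s, 0 ≤ g s) → (∀ s, g s ≤ 1) →
        (∫ s in (0 : ℝ)..L, g s * normalSliceEnergyReal Φ.ψ ((0 : Fin (n + 1)), a) (L - s)) +
            (groundStateEnergy v n L).toReal *
              (∫ s in (0 : ℝ)..L, g s * marginalMassReal Φ.ψ ((0 : Fin (n + 1)), a) (L - s)) ≤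
          ∫ s in (0 : ℝ)..L, g s * sliceEnergyReal v Φ.ψ ((0 : Fin (n + 1)), a) (L - s)) := by
  intro v hv n L hL Φ hE a
  have hψ : ContDiff ℝ 1 Φ.ψ := Φ.contDiff
  have hsupp : HasCompactSupport Φ.ψ := TrialState.hasCompactSupport' Φ
  have hML : marginalMassReal Φ.ψ ((0 : Fin (n + 1)), a) L = 0 :=
    marginalMassReal_eq_zero_of_not_mem Φ _ (fun h => lt_irrefl _ h.2)
  refine ⟨?_, hML, ?_, ?_, ?_, ?_, ?_, ?_, ?_, ?_, ?_⟩
  · exact (continuous_marginalMassReal hψ hsupp _).comp (continuous_const.sub continuous_id)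
  · exact fun s => integral_nonneg fun y => sq_nonneg _
  · exact (integrable_sliceCurrent hψ hsupp _).comp_sub_left L
  · exact (integrable_normalSliceEnergyReal hψ hsupp _).comp_sub_left L
  · exact (integrable_sliceEnergyReal hv Φ hE _).comp_sub_left L
  · intro s
    have h := marginalMassReal_comp_sub_eq_integral hψ hsupp ((0 : Fin (n + 1)), a) L s
    rw [hML, sub_zero] at h
    exact h
  · exact fun s => ⟨integral_nonneg fun y => sq_nonneg _, neg_two_mul_sliceCurrent_sq_le hψ hsupp _ _⟩
  · exact (Measure.measurePreserving_sub_left volume L).quasiMeasurePreserving.ae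
      (ae_normalSliceEnergyReal_le_sliceEnergyReal hv Φ hE ((0 : Fin (n + 1)), a))
  · intro g hg hg1 D hD0 hgD δ hδ hΦδ
    exact abs_virial_le hv hL Φ hE _ hg hg1 hD0 hgD hδ hΦδ
  · intro g hg hg0 hg1
    exact sliceBound_real hv hL Φ hE a hg.continuous hg0 hg1

end Summit.AtomisticToContinuum.BoseEinsteinCondensation.Theorems.RigidMomentumBound

end
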